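import Summits.QuantumAdvantage.QuantumAdvantage.Theorems.HintDialDuality
import Summits.QuantumAdvantage.QuantumAdvantage.Theorems.HintDialAutomaton
import Literature.Computability.QuantumComplexity.ForrelationDirectSum
import Literature.Computability.QuantumComplexity.IQPForrelation
import Literature.Computability.QuantumComplexity.SignedForrelationGadget

/-!
# FlatDialMMDual — module 7 of the lens-3 g11 «FlatDial» THEOREMS package (cell decomp-qadv): Maiorana–McFarland duality for an ARBITRARY permutation key

The tree has Maiorana–McFarland duality for LINEAR keys only (`HintDial.isDualOf_blTable`, `HintDialPlanting.isDualOf_Fw_G0`).  The planted function of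
record §12 (`W_M`, the rigid certificate) is the cube-key MM direct sum `Σ_j Tr(x_j y_j³)` — a NONLINEAR (quadratic) permutation key — under an outer frame
(`HintDial.isDualOf_affine` does the frame).  This module supplies the missing general fact [Carlet2020, Prop. 54 ff.; Mesnager2016, Prop. 7.1.14]:

* `mmFun π h (x₁x₂) = ⟨x₁, π x₂⟩ ⊕ h x₂` on `Fin (k + k) → Bool` (`bd` = the dot product of `HintDial.Automaton`);
* `mmDualFn σ h (y₁y₂) = ⟨σ y₁, y₂⟩ ⊕ h (σ y₁)`;
* ★ `W_mmFun` : for a two-sided inverse pair `π ∘ σ = id = σ ∘ π`, `W_{(-1)^{mmFun}}(y₁y₂) = 2^k · (-1)^{h(σ y₁)} (-1)^{⟨σ y₁, y₂⟩}`;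
* ★★ `isDualOf_mmFun` : `IsDualOf (mmFun π h) (mmDualFn σ h)` — so `(mmFun π h, mmDualFn σ h)` is an exact `+1` pair (`HintDial.forrelation_eq_one_of_isDualOf`).

ZERO `def X : Prop`.  Provenance: HOME/decomp-qadv-lens-3/g11/ (record NODE-g11.md §12, LAND-g11.md step 7).
-/

set_option linter.dupNamespace false

noncomputable section

namespace Summit.QuantumAdvantage.QuantumAdvantage.Theorems.FlatDial

open Finset
open Literature.Computability.QuantumComplexity
open Literature.Computability.QuantumComplexity.BuzetChailloux (bxor zeroVec bxor_eq_zeroVec_iff sum_twist_left twist_bxor_right)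
open Literature.Computability.QuantumComplexity.DerivativeWalsh (W)
open Summit.QuantumAdvantage.QuantumAdvantage.Theorems.HintDial (IsDualOf)
open Summit.QuantumAdvantage.QuantumAdvantage.Theorems.HintDial.Automaton (bd signOf_bd)

variable {k : ℕ}

/-- The Maiorana–McFarland function with permutation key `π` and offset `h`: `(x₁,x₂) ↦ ⟨x₁, π x₂⟩ ⊕ h x₂`.
[cite: Carlet2020, Prop. 54] -/
def mmFun (π : (Fin k → Bool) → (Fin k → Bool)) (h : (Fin k → Bool) → Bool) (x : Fin (k + k) → Bool) : Bool :=
  xor (bd (fun i => x (Fin.castAdd k i)) (π fun i => x (Fin.natAdd k i))) (h fun i => x (Fin.natAdd k i))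

/-- Its Maiorana–McFarland dual for the inverse key `σ = π⁻¹`: `(y₁,y₂) ↦ ⟨σ y₁, y₂⟩ ⊕ h (σ y₁)`. [cite: Carlet2020, Prop. 54] -/
def mmDualFn (σ : (Fin k → Bool) → (Fin k → Bool)) (h : (Fin k → Bool) → Bool) (y : Fin (k + k) → Bool) : Bool :=
  xor (bd (σ fun i => y (Fin.castAdd k i)) (fun i => y (Fin.natAdd k i))) (h (σ fun i => y (Fin.castAdd k i)))

/-- `mmFun` on appended arguments. -/
theorem mmFun_append (π : (Fin k → Bool) → (Fin k → Bool)) (h : (Fin k → Bool) → Bool) (x₁ x₂ : Fin k → Bool) :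
    mmFun π h (Fin.append x₁ x₂) = xor (bd x₁ (π x₂)) (h x₂) := by
  simp only [mmFun, Fin.append_left, Fin.append_right]

/-- `mmDualFn` on appended arguments. -/
theorem mmDualFn_append (σ : (Fin k → Bool) → (Fin k → Bool)) (h : (Fin k → Bool) → Bool) (y₁ y₂ : Fin k → Bool) :
    mmDualFn σ h (Fin.append y₁ y₂) = xor (bd (σ y₁) y₂) (h (σ y₁)) := by
  simp only [mmDualFn, Fin.append_left, Fin.append_right]

variable {π σ : (Fin k → Bool) → (Fin k → Bool)} {h : (Fin k → Bool) → Bool}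

/-- a two-sided inverse pair: `π x = t ↔ x = σ t`. -/
theorem key_eq_iff (hπσ : ∀ t, π (σ t) = t) (hσπ : ∀ x, σ (π x) = x) (x t : Fin k → Bool) : π x = t ↔ x = σ t :=
  ⟨fun e => by rw [← e, hσπ], fun e => by rw [e, hπσ]⟩

/-- ★ THE WALSH TRANSFORM of a Maiorana–McFarland function with an arbitrary permutation key.
[cite: Carlet2020, Prop. 54; Mesnager2016, Prop. 7.1.14] -/
theorem W_mmFun (hπσ : ∀ t, π (σ t) = t) (hσπ : ∀ x, σ (π x) = x) (y₁ y₂ : Fin k → Bool) :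
    W (fun x => signOf (mmFun π h x)) (Fin.append y₁ y₂) = 2 ^ k * (signOf (h (σ y₁)) * twist (σ y₁) y₂) := by
  rw [DerivativeWalsh.W, sum_append]
  simp_rw [mmFun_append, twist_append, signOf_xor, signOf_bd]
  rw [sum_comm]
  have inner : ∀ x₂ : Fin k → Bool,
      ∑ x₁ : Fin k → Bool, twist x₁ (π x₂) * signOf (h x₂) * (twist x₁ y₁ * twist x₂ y₂)
        = (signOf (h x₂) * twist x₂ y₂) * (if x₂ = σ y₁ then (2 : ℝ) ^ k else 0) := by
    intro x₂
    have e : ∀ x₁ : Fin k → Bool, twist x₁ (π x₂) * signOf (h x₂) * (twist x₁ y₁ * twist x₂ y₂)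
        = (signOf (h x₂) * twist x₂ y₂) * twist x₁ (bxor (π x₂) y₁) := fun x₁ => by
      rw [twist_bxor_right]; ring
    simp_rw [e]
    rw [← mul_sum, sum_twist_left]
    simp only [bxor_eq_zeroVec_iff, key_eq_iff hπσ hσπ]
  simp_rw [inner, mul_ite, mul_zero, Finset.sum_ite_eq', Finset.mem_univ, if_true]
  ring

/-- ★★ MAIORANA–McFARLAND DUALITY for an arbitrary permutation key: `mmDualFn σ h` is the dual of `mmFun π h`.
[cite: Carlet2020, Prop. 54; Mesnager2016, Prop. 7.1.14] -/
theorem isDualOf_mmFun (hπσ : ∀ t, π (σ t) = t) (hσπ : ∀ x, σ (π x) = x) : IsDualOf (mmFun π h) (mmDualFn σ h) := by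
  intro y
  obtain ⟨⟨y₁, y₂⟩, rfl⟩ := (Fin.appendEquiv k k).surjective y
  show W _ (Fin.append y₁ y₂) = _ * signOf (mmDualFn σ h (Fin.append y₁ y₂))
  rw [W_mmFun hπσ hσπ, mmDualFn_append, signOf_xor, signOf_bd, SgnForrMem.sqrt_two_pow_add_self]
  ring

/-- Hence `(mmFun π h, mmDualFn σ h)` is an EXACT `+1` pair. -/
theorem forrelation_mmFun_mmDualFn (hπσ : ∀ t, π (σ t) = t) (hσπ : ∀ x, σ (π x) = x) :
    forrelation (mmFun π h) (mmDualFn σ h) = 1 :=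
  HintDial.forrelation_eq_one_of_isDualOf (isDualOf_mmFun hπσ hσπ)

end Summit.QuantumAdvantage.QuantumAdvantage.Theorems.FlatDial
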